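import Summits.BirchSwinnertonDyer.Rank1Residual.X1.GeneratorCountTorsion
import Summits.BirchSwinnertonDyer.Rank1Residual.X1.GeneratorCountAnomalousLeafStrict
import Literature.NumberTheory.EllipticCurves.IwasawaTowerTorsionOrdinaryProofs
import HarnessLib

/-!
# Route M's generator COUNT, VII (V80 over `ℚ`): `GeneratorCountGE W p b` for `b + 2k ≤ #S + 2` at a
# member WITH a rational `p`-torsion point (`#E(ℚ)[p^∞] ≤ p^k`), and the three leaf ends —
# the count `B = t₀ + a − 2δ` of X1R0-GAPMAP §14.1 at `δ = 1` IN THE KERNEL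
# (cell `b2b-bsdres`, unit `b2b-bsdres-eisenstein-p1`, gen 16)

HONEST FRAMING (run/shared/lean/b2b/bsd-rank1-residual/, verbatim in every file): the goal of the
cell is to DELETE the COMBINATION-SHAPED residual classes of the Birch–Swinnerton-Dyer formula for
ALL analytic-rank `≤ 1` elliptic curves over `ℚ` — "full BSD formula for every rank `≤ 1` curve in
class `C`" assembled STRICTLY from published theorems — so that the rank-`≤ 1` remainder becomes
exactly the CONSTRUCTION-SHAPED classes, which are TYPED (missing-input `Prop`s), NOT attempted.
This is not "finishing BSD". Sub-cell `b2b-bsdres-eisenstein-p1`: research route; NO CLAIM BEYOND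
STATED CLASSES; nothing here changes a label; nothing is booked (the per-pair rows served are
EVIDENCE of this unit's table, referee to countersign). THEOREMS ONLY (no `def`, no named fact
introduced): named facts as in FILE VI's predecessors (Poitou–Tate duality over `ℚ` `hPT`,
Greenberg 1999 Prop. 2.4 `hGrK`, and on the leaf Wuthrich 2014 Thm. 16, Greenberg Thm. 4.1 /
Prop. 3.10 / Prop. 4.15 (ii), modularity, Gross–Zagier–Kolyvagin).

What. FILE VI (`X1/GeneratorCountTorsion`) proved `#S ≤ #(X/𝔪X) · (#E[p^∞]^{Γ_ℚ})²` for every finite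
subgroup `S` of admissible classes of `H¹(ℚ, E[p])`, for any `ℤ_p`-extension with `E(ℚ_∞)[p^∞]`
finite — which the tree PROVES for the cyclotomic one at an odd good ordinary prime
(`finite_fixedPoints_kerSubgroup_geomPrimaryTorsion_of_ordinary`: `E(ℚ_∞)[p^∞] = E(ℚ)[p^∞]`). With
n1011's relaxed Kummer structure (`exists_addSubgroup_relaxedKummer_atP(_two)`: `#S ≥ p^{#T₀+1}`,
resp. `p^{#T₀+2}` given a `ℚ_p`-point of order `p`) this gives, for `#E[p^∞]^{Γ_ℚ} ≤ p^k`: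
* `generatorCountGE_of_tamagawaWitnesses_atP_two_torsion`, `…_of_dvd_localTamagawaNumber_atP_two_torsion`
  — **`GeneratorCountGE W p b` whenever `b + 2k ≤ #S + 2`** (`S` = places `v ∤ p` with `p ∣ c_v`;
  `hloc` as in FILE 3 — a THEOREM on the leaf, V79), and the `#S + 1` forms without the
  `ℚ_p`-point;
* on the leaf (`Leaf.…_torsion`): the three consumers (`μ = 0`, `μ = 0` ∩ second certificate,
  `μ ≥ 1` member) with `hloc` discharged by `hGrK` (FILE V `Leaf.hloc_of_prop24`) and the
  `ℚ_p`-point supplied by a rational point of order `p` (`hPt`, at a `δ = 1` member the rational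
  `p`-torsion point itself: `a = 2` for free), so that with `k = 1` the count is `b = #S = t₀` —
  X1R0-GAPMAP §14.1's `B = t₀ + a − 2δ` at `δ = 1`. Census stakes (§24.2): the 305 route-M₀
  closures of record binding at `δ = 1` members.
The torsion datum `hB : #E[p^∞]^{Γ_ℚ} ≤ p^k` is Galois descent of `#E(ℚ)[p^∞] ≤ p^k` (per member:
`k = v_p(#E(ℚ)_tors)`, `= 1` throughout the `p = 3` census); its derivation from `W.torsionOrder`
is left to a sequel.

References: [GreenbergLNM1716] §3 Lemma 3.1, Lemma 3.4, §4 Lemma 4.3, §5 p. 114, p. 137;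
X1R0-GAPMAP §14.1, §24.2, §25.
-/

noncomputable section

open scoped Classical

open Function Field NumberField IsDedekindDomain WeierstrassCurve
  Literature.NumberTheory.EllipticCurves Literature.NumberTheory.GaloisRepresentations
  Literature.NumberTheory.GaloisCohomology Summit.BirchSwinnertonDyer.Rank1Residual.GaloisImage
  Summit.BirchSwinnertonDyer.Rank1Residual.X1.GeneratorCountAnomalous
  Summit.BirchSwinnertonDyer.Rank1Residual.X1.GeneratorCountAnomalousTwo
  Summit.BirchSwinnertonDyer.Rank1Residual.X1.GeneratorCountSqueeze
open Literature.NumberTheory.GaloisRepresentations.DiscreteGaloisModule (unramifiedSubgroup)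

set_option autoImplicit false

namespace Summit.BirchSwinnertonDyer.Rank1Residual.X1.GeneratorCountTorsion

variable {W : WeierstrassCurve ℚ} [W.IsElliptic] [W.IsGloballyMinimal] {p : ℕ} [hp : Fact p.Prime]

/-! ## §5. `GeneratorCountGE W p b` for `b + 2k ≤ #T₀ + 2` without `p ∤ #E(ℚ)_tors` -/

section Count

/-- **`GeneratorCountGE W p b` from Tamagawa witnesses, the local condition at `p`, a `ℚ_p`-point
of order `p`, and `#E[p^∞]^{Γ_ℚ} ≤ p^k`, for every `b` with `b + 2k ≤ #T₀ + 2`** (`p` odd good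
ordinary — for the finiteness `E(ℚ_∞)[p^∞] = E(ℚ)[p^∞]`; named fact `hPT`; hypothesis `hloc` of
FILE 3, a theorem at anomalous `p`). [cite: GreenbergLNM1716, §3 Lemma 3.1, Lemma 3.4, §5 pp. 114–118, p. 137] -/
theorem generatorCountGE_of_tamagawaWitnesses_atP_two_torsion (hodd : p ≠ 2)
    (hPT : poitouTate_selmerStructure_duality ℚ) (hgood : W.HasGoodReductionAtPrime p)
    (hord : ¬ (p : ℤ) ∣ W.frobeniusTrace p) {k : ℕ}
    (hB : Nat.card {a : geomPrimaryTorsion W p // ∀ σ : absoluteGaloisGroup ℚ, σ • a = a} ≤ p ^ k)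
    (hloc : ∀ (κ : ZpExtension ℚ p), κ.IsCyclotomic → ∀ (v : HeightOneSpectrum (𝓞 ℚ)),
      ((p : ℕ) : 𝓞 ℚ) ∈ v.asIdeal → ∀ y : galH1Torsion W (p : ℤ),
      W.layerToInfty κ 0 (resH1Hom (Literature.NumberTheory.EllipticCurves.subgroupIncl (κ.layerSubgroup 0))
          (AddMonoidHom.id (geomPrimaryTorsion W p)) (fun _ _ ↦ rfl) (torsionToPrimaryH1 W p y)) ∈
        W.localKerOver p κ.kerSubgroup (v.adicCompletion ℚ))
    (T₀ : Finset (HeightOneSpectrum (𝓞 ℚ))) (hT₀p : ∀ v ∈ T₀, ((p : ℕ) : 𝓞 ℚ) ∉ v.asIdeal)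
    (hwit : ∀ v ∈ T₀, ∃ u ∈ unramifiedSubgroup
        ((W.torsionGaloisModule (p : ℤ)).restrictField (v.adicCompletion ℚ)) 1,
      u ∉ W.kummerLocalConditionAt (p : ℤ) (v.adicCompletion ℚ))
    (vp : HeightOneSpectrum (𝓞 ℚ)) (hvp : ((p : ℕ) : 𝓞 ℚ) ∈ vp.asIdeal)
    (hPt : ∃ P : (W.baseChange (vp.adicCompletion ℚ)).toAffine.Point, P ≠ 0 ∧ p • P = 0)
    {b : ℕ} (hb : b + 2 * k ≤ T₀.card + 2) : GeneratorCountGE W p b := by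
  haveI : NeZero p := ⟨hp.out.ne_zero⟩
  obtain ⟨inv, hperf, hsum, -, hcompl⟩ := hPT p
  intro κ γ hκ _ _ D _ _
  haveI := W.finite_fixedPoints_kerSubgroup_geomPrimaryTorsion_of_ordinary κ hodd hgood hord hκ
  obtain ⟨Sg, hSfin, hcard, hS⟩ :=
    exists_addSubgroup_relaxedKummer_atP_two hodd inv hperf hsum hcompl T₀ hT₀p hwit vp hvp hPt
  haveI := hSfin
  have hcount := natCard_le_natCard_quotient_maximalIdeal_mul_sq W κ D Sg
    (↑(insert vp T₀) : Set (HeightOneSpectrum (𝓞 ℚ))) (fun y hy v hv ↦ (hS y hy).1 v hv)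
    (fun y hy w ↦ (hS y hy).2.1 w) fun y hy v hv ↦ by
      rcases Finset.mem_insert.mp (Finset.mem_coe.mp hv) with rfl | hv
      · exact hloc κ hκ v hvp y
      · exact Additive.layerToInfty_resH1Hom_torsionToPrimaryH1_mem_localKerOver_of_mem_unramified_sup_kummer
          W p κ v (hT₀p v hv) (Additive.exists_apply_resGal_ne_one_of_isCyclotomic κ hκ v (hT₀p v hv)) y
          ((hS y hy).2.2 v hv)
  have h1 : p ^ b * p ^ (2 * k) ≤ Nat.card (D.X ⧸ IsLocalRing.maximalIdeal (IwasawaAlgebra p) •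
      (⊤ : Submodule (IwasawaAlgebra p) D.X)) * p ^ (2 * k) :=
    calc p ^ b * p ^ (2 * k) = p ^ (b + 2 * k) := (pow_add p b (2 * k)).symm
      _ ≤ p ^ (T₀.card + 2) := Nat.pow_le_pow_right hp.out.pos hb
      _ ≤ Nat.card Sg := hcard
      _ ≤ _ := hcount
      _ ≤ Nat.card (D.X ⧸ IsLocalRing.maximalIdeal (IwasawaAlgebra p) •
            (⊤ : Submodule (IwasawaAlgebra p) D.X)) * (p ^ k) ^ 2 :=
          Nat.mul_le_mul_left _ (Nat.pow_le_pow_left hB 2)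
      _ = _ := by rw [← pow_mul, mul_comm k 2]
  exact Nat.le_of_mul_le_mul_right h1 (pow_pos hp.out.pos _)

/-- **The same with the count `#T₀ + 1`** (no `ℚ_p`-point needed): `GeneratorCountGE W p b` for
`b + 2k ≤ #T₀ + 1`. [cite: GreenbergLNM1716, §3 Lemma 3.1, Lemma 3.4, §5 pp. 114–118, p. 137] -/
theorem generatorCountGE_of_tamagawaWitnesses_atP_torsion (hodd : p ≠ 2)
    (hPT : poitouTate_selmerStructure_duality ℚ) (hgood : W.HasGoodReductionAtPrime p)
    (hord : ¬ (p : ℤ) ∣ W.frobeniusTrace p) {k : ℕ}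
    (hB : Nat.card {a : geomPrimaryTorsion W p // ∀ σ : absoluteGaloisGroup ℚ, σ • a = a} ≤ p ^ k)
    (hloc : ∀ (κ : ZpExtension ℚ p), κ.IsCyclotomic → ∀ (v : HeightOneSpectrum (𝓞 ℚ)),
      ((p : ℕ) : 𝓞 ℚ) ∈ v.asIdeal → ∀ y : galH1Torsion W (p : ℤ),
      W.layerToInfty κ 0 (resH1Hom (Literature.NumberTheory.EllipticCurves.subgroupIncl (κ.layerSubgroup 0))
          (AddMonoidHom.id (geomPrimaryTorsion W p)) (fun _ _ ↦ rfl) (torsionToPrimaryH1 W p y)) ∈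
        W.localKerOver p κ.kerSubgroup (v.adicCompletion ℚ))
    (T₀ : Finset (HeightOneSpectrum (𝓞 ℚ))) (hT₀p : ∀ v ∈ T₀, ((p : ℕ) : 𝓞 ℚ) ∉ v.asIdeal)
    (hwit : ∀ v ∈ T₀, ∃ u ∈ unramifiedSubgroup
        ((W.torsionGaloisModule (p : ℤ)).restrictField (v.adicCompletion ℚ)) 1,
      u ∉ W.kummerLocalConditionAt (p : ℤ) (v.adicCompletion ℚ))
    (vp : HeightOneSpectrum (𝓞 ℚ)) (hvp : ((p : ℕ) : 𝓞 ℚ) ∈ vp.asIdeal)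
    {b : ℕ} (hb : b + 2 * k ≤ T₀.card + 1) : GeneratorCountGE W p b := by
  haveI : NeZero p := ⟨hp.out.ne_zero⟩
  obtain ⟨inv, hperf, hsum, -, hcompl⟩ := hPT p
  intro κ γ hκ _ _ D _ _
  haveI := W.finite_fixedPoints_kerSubgroup_geomPrimaryTorsion_of_ordinary κ hodd hgood hord hκ
  obtain ⟨Sg, hSfin, hcard, hS⟩ :=
    exists_addSubgroup_relaxedKummer_atP hodd inv hperf hsum hcompl T₀ hT₀p hwit vp hvp
  haveI := hSfin
  have hcount := natCard_le_natCard_quotient_maximalIdeal_mul_sq W κ D Sg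
    (↑(insert vp T₀) : Set (HeightOneSpectrum (𝓞 ℚ))) (fun y hy v hv ↦ (hS y hy).1 v hv)
    (fun y hy w ↦ (hS y hy).2.1 w) fun y hy v hv ↦ by
      rcases Finset.mem_insert.mp (Finset.mem_coe.mp hv) with rfl | hv
      · exact hloc κ hκ v hvp y
      · exact Additive.layerToInfty_resH1Hom_torsionToPrimaryH1_mem_localKerOver_of_mem_unramified_sup_kummer
          W p κ v (hT₀p v hv) (Additive.exists_apply_resGal_ne_one_of_isCyclotomic κ hκ v (hT₀p v hv)) y
          ((hS y hy).2.2 v hv)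
  have h1 : p ^ b * p ^ (2 * k) ≤ Nat.card (D.X ⧸ IsLocalRing.maximalIdeal (IwasawaAlgebra p) •
      (⊤ : Submodule (IwasawaAlgebra p) D.X)) * p ^ (2 * k) :=
    calc p ^ b * p ^ (2 * k) = p ^ (b + 2 * k) := (pow_add p b (2 * k)).symm
      _ ≤ p ^ (T₀.card + 1) := Nat.pow_le_pow_right hp.out.pos hb
      _ ≤ Nat.card Sg := hcard
      _ ≤ _ := hcount
      _ ≤ Nat.card (D.X ⧸ IsLocalRing.maximalIdeal (IwasawaAlgebra p) •
            (⊤ : Submodule (IwasawaAlgebra p) D.X)) * (p ^ k) ^ 2 :=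
          Nat.mul_le_mul_left _ (Nat.pow_le_pow_left hB 2)
      _ = _ := by rw [← pow_mul, mul_comm k 2]
  exact Nat.le_of_mul_le_mul_right h1 (pow_pos hp.out.pos _)

/-- **`GeneratorCountGE W p b` for `b + 2k ≤ #S + 2` from `p ∣ c_v` on `S`, a `ℚ_p`-point of order `p`
and `#E[p^∞]^{Γ_ℚ} ≤ p^k`** — route T's layer-`0` count `B = t₀ + a − 2δ` (X1R0-GAPMAP §14.1) at a
member WITH rational `p`-torsion, in the kernel modulo `hPT` and `hloc`. The Tamagawa witnesses are
the tree's (Kodaira–Néron at additive `v`, Tate at split multiplicative `v`), as in FILE 2.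
[cite: GreenbergLNM1716, §3 p. 88, Lemma 3.4 (p. 89), §5 pp. 114–118, p. 137] -/
theorem generatorCountGE_of_dvd_localTamagawaNumber_atP_two_torsion (hodd : p ≠ 2)
    (hPT : poitouTate_selmerStructure_duality ℚ) (hgood : W.HasGoodReductionAtPrime p)
    (hord : ¬ (p : ℤ) ∣ W.frobeniusTrace p) {k : ℕ}
    (hB : Nat.card {a : geomPrimaryTorsion W p // ∀ σ : absoluteGaloisGroup ℚ, σ • a = a} ≤ p ^ k)
    (hloc : ∀ (κ : ZpExtension ℚ p), κ.IsCyclotomic → ∀ (v : HeightOneSpectrum (𝓞 ℚ)),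
      ((p : ℕ) : 𝓞 ℚ) ∈ v.asIdeal → ∀ y : galH1Torsion W (p : ℤ),
      W.layerToInfty κ 0 (resH1Hom (Literature.NumberTheory.EllipticCurves.subgroupIncl (κ.layerSubgroup 0))
          (AddMonoidHom.id (geomPrimaryTorsion W p)) (fun _ _ ↦ rfl) (torsionToPrimaryH1 W p y)) ∈
        W.localKerOver p κ.kerSubgroup (v.adicCompletion ℚ))
    (S : Finset (HeightOneSpectrum (𝓞 ℚ))) (hSp : ∀ v ∈ S, ((p : ℕ) : 𝓞 ℚ) ∉ v.asIdeal)
    (hcv : ∀ v ∈ S,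
      p ∣ (W.baseChange (v.adicCompletion ℚ)).localTamagawaNumber (v.adicCompletionIntegers ℚ))
    (vp : HeightOneSpectrum (𝓞 ℚ)) (hvp : ((p : ℕ) : 𝓞 ℚ) ∈ vp.asIdeal)
    (hPt : ∃ P : (W.baseChange (vp.adicCompletion ℚ)).toAffine.Point, P ≠ 0 ∧ p • P = 0)
    {b : ℕ} (hb : b + 2 * k ≤ S.card + 2) : GeneratorCountGE W p b :=
  generatorCountGE_of_tamagawaWitnesses_atP_two_torsion hodd hPT hgood hord hB hloc S hSp
    (fun v hv ↦ by
      haveI : Finite (IsLocalRing.ResidueField (v.adicCompletionIntegers ℚ)) :=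
        HeightOneSpectrum.finite_residueField_adicCompletionIntegers ℚ v
      rcases Additive.hasAdditiveReductionAt_or_hasSplitMultiplicativeReductionAt_of_dvd_localTamagawaNumber
          W v hodd (hcv v hv) with hadd | hsplit
      · exact Additive.exists_mem_unramifiedSubgroup_not_mem_kummerLocalConditionAt_of_hasAdditiveReductionAt
          W p v (hSp v hv) hodd hadd (hcv v hv)
      · exact Additive.exists_mem_unramifiedSubgroup_not_mem_kummerLocalConditionAt_of_split_of_dvd_localTamagawaNumber
          W v hsplit (hSp v hv) (hcv v hv)) vp hvp hPt hb

end Count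

/-! ## §6. On the leaf X1 ∩ {r = 0}: route M at a member WITH rational `p`-torsion -/

section Leaf

open Literature.NumberTheory.EllipticCurves.Rank1Residual
  Literature.NumberTheory.EllipticCurves.ModularForms
  Literature.NumberTheory.EllipticCurves.Greenberg1999
  Summit.BirchSwinnertonDyer.BirchSwinnertonDyer.Theorems.Rank1ResidualX1Defs
  Summit.BirchSwinnertonDyer.Rank1Residual.X1.MuLambda
  Summit.BirchSwinnertonDyer.Rank1Residual.X1.MuPart
  Summit.BirchSwinnertonDyer.Rank1Residual.X1.ParitySqueeze
  Summit.BirchSwinnertonDyer.Rank1Residual.X1.TamagawaSqueeze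
  Summit.BirchSwinnertonDyer.Rank1Residual.X1.FactorSqueeze
  Summit.BirchSwinnertonDyer.Rank1Residual.X1.GeneratorSqueeze
  Summit.BirchSwinnertonDyer.Rank1Residual.X1.GeneratorCountSqueeze
  Summit.BirchSwinnertonDyer.Rank1Residual.X1.GeneratorCountSqueezeFacts
  Summit.BirchSwinnertonDyer.Rank1Residual.X1.GeneratorCountAnomalousLeaf

/-- **The count on the leaf at a member with rational `p`-torsion**: for a leaf pair `(E, p)`, a
finite set `S` of places `v ∤ p` with `p ∣ c_v(E)`, a `ℚ_p`-point of order `p` (e.g. the image of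
a rational one) and `#E[p^∞]^{Γ_ℚ} ≤ p^k`: `GeneratorCountGE W p b` for all `b + 2k ≤ #S + 2`
(named facts `hPT`, `hGrK`; `hloc` discharged by V79). [cite: GreenbergLNM1716, §2 Prop. 2.4, §3 Lemma 3.4, §5, p. 137] -/
theorem Leaf.generatorCountGE_torsion (hPT : poitouTate_selmerStructure_duality ℚ)
    (hGrK : imKummer_ge_strictCondition_goodOrdinary) (hL : RankZero.Leaf W p) {k : ℕ}
    (hB : Nat.card {a : geomPrimaryTorsion W p // ∀ σ : absoluteGaloisGroup ℚ, σ • a = a} ≤ p ^ k)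
    (S : Finset (HeightOneSpectrum (𝓞 ℚ))) (hSp : ∀ v ∈ S, ((p : ℕ) : 𝓞 ℚ) ∉ v.asIdeal)
    (hcv : ∀ v ∈ S,
      p ∣ (W.baseChange (v.adicCompletion ℚ)).localTamagawaNumber (v.adicCompletionIntegers ℚ))
    (vp : HeightOneSpectrum (𝓞 ℚ)) (hvp : ((p : ℕ) : 𝓞 ℚ) ∈ vp.asIdeal)
    (hPt : ∃ P : (W.baseChange (vp.adicCompletion ℚ)).toAffine.Point, P ≠ 0 ∧ p • P = 0)
    {b : ℕ} (hb : b + 2 * k ≤ S.card + 2) : GeneratorCountGE W p b :=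
  have hX := isClassX1_of_classX1 hL.classX1
  generatorCountGE_of_dvd_localTamagawaNumber_atP_two_torsion hX.two_ne hPT hX.hasGoodReductionAtPrime
    hX.not_dvd_frobeniusTrace hB (GeneratorCountAnomalousLeaf.Leaf.hloc_of_prop24 hGrK hL) S hSp hcv
    vp hvp hPt hb

/-- **ROUTE M at the `μ = 0` member WITH rational `p`-torsion (`δ = 1`), count `b` with
`b + 2k ≤ #S + 2`:** `μ_an = 0 ∧ λ_an = n ∧ (p ∣ c_v on S) ∧ ℚ_p-point of order p ∧
#E[p^∞]^{Γ_ℚ} ≤ p^k ∧ (Newton data S') ∧ gap ⇒ BSD(E,p)`. [cite: GreenbergLNM1716, §2 Prop. 2.4,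
§3 Lemma 3.1/3.4, Prop. 3.10, Thm. 4.1, §5 pp. 114–118, p. 137] [cite: Wuthrich2014, Thm. 16 (p. 397)] -/
theorem Leaf.bsdp_of_muZero_of_tamagawaCountAtP_torsion
    (hW16 : Wuthrich2014.charIdeal_dvd_padicLFunction) (hGr : greenberg_charValue_rankZero)
    (h310 : prop310_selmerCorank_mod_two_eq_lambdaInvariant)
    (h415 : prop415ii_noFiniteSubmodule_of_ordinary_or_multiplicative)
    (hmod : nonempty_modularParametrizationData)
    (hGZK : rank_eq_analyticRank_of_analyticRank_le_one)
    (hPT : poitouTate_selmerStructure_duality ℚ) (hGrK : imKummer_ge_strictCondition_goodOrdinary)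
    (hL : RankZero.Leaf W p) {k : ℕ}
    (hB : Nat.card {a : geomPrimaryTorsion W p // ∀ σ : absoluteGaloisGroup ℚ, σ • a = a} ≤ p ^ k)
    (hμ0 : AnalyticMuLE W p 0) {n b : ℕ} {S' : Set (ℕ × ℕ)} (hlam : AnalyticLambdaEq W p n)
    (S : Finset (HeightOneSpectrum (𝓞 ℚ))) (hSp : ∀ v ∈ S, ((p : ℕ) : 𝓞 ℚ) ∉ v.asIdeal)
    (hcv : ∀ v ∈ S,
      p ∣ (W.baseChange (v.adicCompletion ℚ)).localTamagawaNumber (v.adicCompletionIntegers ℚ))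
    (vp : HeightOneSpectrum (𝓞 ℚ)) (hvp : ((p : ℕ) : 𝓞 ℚ) ∈ vp.asIdeal)
    (hPt : ∃ P : (W.baseChange (vp.adicCompletion ℚ)).toAffine.Point, P ≠ 0 ∧ p • P = 0)
    (hb : b + 2 * k ≤ S.card + 2) (hS : AnalyticLamConstValDivisorSet W p S')
    (hgap : ∀ d v, (d, v) ∈ S' → b ≤ v → Even d → d ≤ n → n ≤ d + 1) : BSDp W p :=
  Leaf.bsdp_of_muZero_of_generatorCount_of_prop415 hW16 hGr h310 h415 hmod hGZK hL hμ0 hlam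
    (Leaf.generatorCountGE_torsion hPT hGrK hL hB S hSp hcv vp hvp hPt hb) hS hgap

/-- **The same intersected with a second membership certificate** (M₀ ∘ C shape).
[cite: GreenbergLNM1716, §2 Prop. 2.4, Prop. 3.10, Thm. 4.1, §5 pp. 114–118, pp. 132, 137] [cite: Wuthrich2014, Thm. 16 (p. 397)] -/
theorem Leaf.bsdp_of_muZero_of_tamagawaCountAtP_torsion_inter
    (hW16 : Wuthrich2014.charIdeal_dvd_padicLFunction) (hGr : greenberg_charValue_rankZero)
    (h310 : prop310_selmerCorank_mod_two_eq_lambdaInvariant)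
    (h415 : prop415ii_noFiniteSubmodule_of_ordinary_or_multiplicative)
    (hmod : nonempty_modularParametrizationData)
    (hGZK : rank_eq_analyticRank_of_analyticRank_le_one)
    (hPT : poitouTate_selmerStructure_duality ℚ) (hGrK : imKummer_ge_strictCondition_goodOrdinary)
    (hL : RankZero.Leaf W p) {k : ℕ}
    (hB : Nat.card {a : geomPrimaryTorsion W p // ∀ σ : absoluteGaloisGroup ℚ, σ • a = a} ≤ p ^ k)
    (hμ0 : AnalyticMuLE W p 0) {n b : ℕ} {S' : Set (ℕ × ℕ)} {A' : Set ℕ}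
    (hlam : AnalyticLambdaEq W p n) (S : Finset (HeightOneSpectrum (𝓞 ℚ)))
    (hSp : ∀ v ∈ S, ((p : ℕ) : 𝓞 ℚ) ∉ v.asIdeal)
    (hcv : ∀ v ∈ S,
      p ∣ (W.baseChange (v.adicCompletion ℚ)).localTamagawaNumber (v.adicCompletionIntegers ℚ))
    (vp : HeightOneSpectrum (𝓞 ℚ)) (hvp : ((p : ℕ) : 𝓞 ℚ) ∈ vp.asIdeal)
    (hPt : ∃ P : (W.baseChange (vp.adicCompletion ℚ)).toAffine.Point, P ≠ 0 ∧ p • P = 0)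
    (hb : b + 2 * k ≤ S.card + 2) (hS : AnalyticLamConstValDivisorSet W p S')
    (hA' : AlgebraicLambdaMem W p A')
    (hgap : ∀ d v, (d, v) ∈ S' → b ≤ v → d ∈ A' → Even d → d ≤ n → n ≤ d + 1) : BSDp W p :=
  Leaf.bsdp_of_muZero_of_generatorCount_inter_of_prop415 hW16 hGr h310 h415 hmod hGZK hL hμ0 hlam
    (Leaf.generatorCountGE_torsion hPT hGrK hL hB S hSp hcv vp hvp hPt hb) hS hA' hgap

/-- **ROUTE M at a `μ ≥ 1` member WITH rational `p`-torsion** (μ-part `MuPartAt W p`), count `b` with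
`b + 2k ≤ #S + 2`. [cite: GreenbergLNM1716, §2 Prop. 2.4, §3 Lemma 3.1/3.4, Prop. 3.10, Thm. 4.1, §5 pp. 114–118, p. 137]
[cite: Wuthrich2014, Thm. 16 (p. 397)] -/
theorem Leaf.bsdp_of_muPartAt_of_tamagawaCountAtP_torsion
    (hW16 : Wuthrich2014.charIdeal_dvd_padicLFunction) (hGr : greenberg_charValue_rankZero)
    (h310 : prop310_selmerCorank_mod_two_eq_lambdaInvariant)
    (h415 : prop415ii_noFiniteSubmodule_of_ordinary_or_multiplicative)
    (hmod : nonempty_modularParametrizationData)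
    (hGZK : rank_eq_analyticRank_of_analyticRank_le_one)
    (hPT : poitouTate_selmerStructure_duality ℚ) (hGrK : imKummer_ge_strictCondition_goodOrdinary)
    (hL : RankZero.Leaf W p) {k : ℕ}
    (hB : Nat.card {a : geomPrimaryTorsion W p // ∀ σ : absoluteGaloisGroup ℚ, σ • a = a} ≤ p ^ k)
    (hμ : MuPartAt W p) {n b : ℕ} {S' : Set (ℕ × ℕ)} (hlam : AnalyticLambdaEq W p n)
    (S : Finset (HeightOneSpectrum (𝓞 ℚ))) (hSp : ∀ v ∈ S, ((p : ℕ) : 𝓞 ℚ) ∉ v.asIdeal)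
    (hcv : ∀ v ∈ S,
      p ∣ (W.baseChange (v.adicCompletion ℚ)).localTamagawaNumber (v.adicCompletionIntegers ℚ))
    (vp : HeightOneSpectrum (𝓞 ℚ)) (hvp : ((p : ℕ) : 𝓞 ℚ) ∈ vp.asIdeal)
    (hPt : ∃ P : (W.baseChange (vp.adicCompletion ℚ)).toAffine.Point, P ≠ 0 ∧ p • P = 0)
    (hb : b + 2 * k ≤ S.card + 2) (hS : AnalyticLamConstValDivisorSet W p S')
    (hgap : ∀ d v, (d, v) ∈ S' → b ≤ v → Even d → d ≤ n → n ≤ d + 1) : BSDp W p :=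
  Leaf.bsdp_of_muPartAt_of_generatorCount_of_prop415 hW16 hGr h310 h415 hmod hGZK hL hμ hlam
    (Leaf.generatorCountGE_torsion hPT hGrK hL hB S hSp hcv vp hvp hPt hb) hS hgap

end Leaf

end Summit.BirchSwinnertonDyer.Rank1Residual.X1.GeneratorCountTorsion

end
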